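import Summits.CriticalPhenomena.SAWScalingLimit.Theorems.SAWDevelopingMapObservableToSLECanonicalTransferFamily
import Summits.CriticalPhenomena.SAWScalingLimit.Theorems.SAWDevelopingMapObservableToSLECanonicalTransferAdmissibleBits
import Summits.CriticalPhenomena.SAWScalingLimit.Theorems.SAWDevelopingMapObservableToSLECanonicalTransferAssembly
import Summits.CriticalPhenomena.SAWScalingLimit.Theorems.SAWDevelopingMapObservableToSLERestrictionCocycleHelpersLattice
import Literature.Probability.RandomPlanarGeometry.CaratheodoryExtension
import Literature.Topology.PlaneTopology.JordanCurveProofs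
import HarnessLib

/-!
# Crux `SAWDevelopingMap.ObservableToSLE` (stmt-CriticalPhenomena-10472), line
`floor-ratio-restriction-bootstrap`, stub `stub_canonicalTransfer`: THE INNER ADMISSIBLE
DISCRETISATION (M1) of the discretisation input of `canonicalTransfer_ofDiscretisation`

Landing target:
`Summits/CriticalPhenomena/SAWScalingLimit/Theorems/SAWDevelopingMapObservableToSLECanonicalTransferDiscretisation.lean`
(`--supports stmt-CriticalPhenomena-10472`).  Sequel of `…CanonicalTransferFamily.lean`,
`…CanonicalTransferAdmissibleBits.lean` and `…CanonicalTransferAssembly.lean`.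

`discretisation_core` proves, for every floor domain `D`, hull subdomain `D'` and canonical
floor-vertex endpoints `a, b`, ALL clauses of the discretisation input of
`canonicalTransfer_ofDiscretisation` EXCEPT the two insensitivity limits (M2'a)
`P^{can}_δ(γ ⊆ Λ δ ∪ {a δ, b δ}) → 1` and (M2'b) `Z_{Λ''δ}/Z_{Λ'δ} → 1`, and exposes the
construction (`Λ δ`, `Λ' δ` = components of the bulk vertex in the deep vertices of `D`, `D'`;
`Λ'' δ` = component of the bulk vertex in `Λ δ ∩ D'`; the floor row `m δ`; the agreement of `D'`
with the flat floor on `B(pt i, 16ρ')`), which is what a proof of (M2'a)/(M2'b) by hull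
super- and sub-domain approximation has to work with.

* `eventually_ne_of_tendsto_nhds`, `mem_embMeshDomain_of_meshAdj`, `hexGraph_adj_floorNeighbour`,
  `mem_embMeshDomain_of_preconnected` (= registered sub-goal
  `stub_canonicalTransfer_meshPropagation`) — small inputs;
* `discretisation_core` — the theorem.
-/

noncomputable section

open scoped Topology
open Filter Set Metric
open Literature.Probability.LatticeModels (HexVertex hexGraph hexCenter Site)
open Literature.Probability.RandomPlanarGeometry
open Literature.Probability.RandomPlanarGeometry.SAW
open Literature.Probability.Percolation (PathIn)

namespace Summit.CriticalPhenomena.SAWScalingLimit.Theorems.ObservableToSLE.FloorRatio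

/-- Two functions converging to distinct points are eventually distinct. [folklore] -/
theorem eventually_ne_of_tendsto_nhds {α : Type*} {l : Filter α} {f g : α → ℂ} {p q : ℂ} (hpq : p ≠ q)
    (hf : Tendsto f l (𝓝 p)) (hg : Tendsto g l (𝓝 q)) : ∀ᶠ x in l, f x ≠ g x := by
  have hd : 0 < dist p q / 2 := half_pos (dist_pos.2 hpq)
  filter_upwards [Metric.tendsto_nhds.1 hf _ hd, Metric.tendsto_nhds.1 hg _ hd] with x h1 h2 heq
  rw [heq] at h1
  have := dist_triangle_left p q (g x)
  linarith

/-- **The discrete domain is closed under mesh steps**: a mesh vertex mesh-adjacent to a vertex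
of `Ω_δ` (a union of components of the mesh graph) lies in `Ω_δ`. [folklore] -/
theorem mem_embMeshDomain_of_meshAdj {V : Type*} {G : SimpleGraph V} {emb : V → ℂ} {Ω : Set ℂ}
    {δ : ℝ} {v w : V} (hv : v ∈ embMeshDomain G emb Ω δ) (hadj : (embMeshGraph G emb Ω δ).Adj v w)
    (hw : w ∈ embMeshVertices emb Ω δ) : w ∈ embMeshDomain G emb Ω δ := by
  simp only [embMeshDomain, Set.mem_iUnion, Set.mem_image] at hv ⊢
  obtain ⟨C, hC, v', hv'C, hv'v⟩ := hv
  refine ⟨C, hC, ⟨w, hw⟩, ?_, rfl⟩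
  rw [SimpleGraph.ConnectedComponent.mem_supp_iff] at hv'C ⊢
  rw [← hv'C]
  refine SimpleGraph.ConnectedComponent.sound (SimpleGraph.Adj.reachable ?_)
  rw [SimpleGraph.induce_adj]
  rw [← hv'v] at hadj
  exact hadj.symm


/-! ### The discretisation input (M1) -/

section Discretisation

/-- Every vertex is adjacent to its floor neighbour (below an up-face, above a down-face). [folklore] -/
theorem hexGraph_adj_floorNeighbour (a : HexVertex) :
    hexGraph.Adj a (if a.2 = 0 then ((a.1 - Pi.single 1 1, 1) : HexVertex) else (a.1 + Pi.single 1 1, 0)) := by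
  obtain ⟨x, k⟩ := a
  fin_cases k
  · simpa using hexGraph_adj_below x
  · simpa using hexGraph_adj_above x

/-- **Membership in the discrete domain propagates along a connected vertex set with mesh
edges.** [folklore] -/
theorem mem_embMeshDomain_of_preconnected {Ω : Set ℂ} {δ : ℝ} {Λ : Finset HexVertex}
    (hconn : (hexGraph.induce (↑Λ : Set HexVertex)).Preconnected)
    (hmesh : ∀ v ∈ Λ, ∀ w ∈ Λ, hexGraph.Adj v w → (embMeshGraph hexGraph hexCenter Ω δ).Adj v w)
    (hΩ : ∀ v ∈ Λ, (δ : ℂ) * hexCenter v ∈ Ω) {i : HexVertex} (hi : i ∈ Λ)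
    (hiM : i ∈ embMeshDomain hexGraph hexCenter Ω δ) {z : HexVertex} (hz : z ∈ Λ) :
    z ∈ embMeshDomain hexGraph hexCenter Ω δ := by
  have key : ∀ (x y : (↑Λ : Set HexVertex)) (p : (hexGraph.induce (↑Λ : Set HexVertex)).Walk x y),
      x.1 ∈ embMeshDomain hexGraph hexCenter Ω δ → y.1 ∈ embMeshDomain hexGraph hexCenter Ω δ := by
    intro x y p
    induction p with
    | nil => exact id
    | @cons u v w huv _ ih =>
      intro hu
      refine ih (mem_embMeshDomain_of_meshAdj hu (hmesh u.1 u.2 v.1 v.2 (SimpleGraph.induce_adj.1 huv)) ?_)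
      exact (mem_embMeshVertices_iff _).2 (hΩ v.1 v.2)
  obtain ⟨p⟩ := hconn ⟨i, hi⟩ ⟨z, hz⟩
  exact key _ _ p hiM

/-- **The inner admissible discretisation matched to the canonical endpoints (input (M1) of
`canonicalTransfer_ofDiscretisation`), with its construction exposed.**  For a floor domain `D`,
a hull subdomain `D'` and canonical floor-vertex endpoints `a, b`, there are `ρ' > 0`, nested
families `Λ' δ ⊆ Λ'' δ ⊆ Λ δ`, the floor row `m δ` and floor mid-edges `σa δ, σb δ` under the
endpoints satisfying every clause of the discretisation input except the two insensitivity limits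
(M2'a), (M2'b): admissibility of `(Λ, Λ')` for `(D, D', ρ')` (simply connected, connected,
boundary mid-edges, walks exist, inside the domains with rows `≥ m δ`, exact rows in the floor
balls), exhaustion of compacts, convergence of the rescaled mid-edges, no bad edges, `D'`-mesh
edges in `Λ'`, `Λ''` closed under `D'`-mesh steps, and the floor matching; TOGETHER WITH the
transparent description: `Λ δ` (`Λ' δ`) is exactly the component of the bulk vertex `v₀ δ` in the
deep vertices of `D` (`D'`) and `Λ'' δ` the component of `v₀ δ` in `Λ δ ∩ D'`. [folklore] -/
theorem discretisation_core :
    ∀ (D D' : DobrushinDomain) (ρ : ℝ) (a b : ℝ → HexVertex),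
    (0 < ρ ∧ (D.pt 1).im = (D.pt 0).im ∧ D.carrier ⊆ {z : ℂ | (D.pt 0).im < z.im} ∧
    D.carrier ∩ ball (D.pt 0) ρ = {z : ℂ | (D.pt 0).im < z.im} ∩ ball (D.pt 0) ρ ∧
    D.carrier ∩ ball (D.pt 1) ρ = {z : ℂ | (D.pt 1).im < z.im} ∩ ball (D.pt 1) ρ) →
    D.IsHullSubdomain D' →
    (IsEmbEndpointApprox hexGraph hexCenter D a b ∧ ∀ᶠ δ : ℝ in 𝓝[>] 0,
    (∃ u : HexVertex, hexGraph.Adj (a δ) u ∧ ((δ : ℂ) * hexCenter u).im ≤ (D.pt 0).im) ∧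
    (∃ u : HexVertex, hexGraph.Adj (b δ) u ∧ ((δ : ℂ) * hexCenter u).im ≤ (D.pt 1).im)) →
    ∃ (ρ' : ℝ) (Λ Λ' Λ'' : ℝ → Finset HexVertex) (m : ℝ → ℤ) (σa σb : ℝ → Sym2 HexVertex),
    0 < ρ' ∧ ρ' ≤ ρ ∧
    (∀ᶠ δ : ℝ in 𝓝[>] 0,
    Λ' δ ⊆ Λ δ ∧ hexDomainSimplyConnected (Λ δ) ∧ hexDomainSimplyConnected (Λ' δ) ∧
    (hexGraph.induce (↑(Λ δ) : Set HexVertex)).Preconnected ∧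
    (hexGraph.induce (↑(Λ' δ) : Set HexVertex)).Preconnected ∧
    σa δ ∈ hexDomainBoundary (Λ δ) ∧ σb δ ∈ hexDomainBoundary (Λ δ) ∧
    σa δ ∈ hexDomainBoundary (Λ' δ) ∧ σb δ ∈ hexDomainBoundary (Λ' δ) ∧
    Nonempty (HexMidEdgeSAW (Λ' δ) (σa δ) (σb δ)) ∧
    (∀ v ∈ Λ δ, (δ : ℂ) * hexCenter v ∈ D.carrier ∧ m δ ≤ v.1 1) ∧
    (∀ v ∈ Λ' δ, (δ : ℂ) * hexCenter v ∈ D'.carrier) ∧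
    (∀ v : HexVertex, (δ : ℂ) * hexCenter v ∈ ball (D.pt 0) ρ' ∪ ball (D.pt 1) ρ' →
    ((v ∈ Λ δ ↔ m δ ≤ v.1 1) ∧ (v ∈ Λ' δ ↔ m δ ≤ v.1 1)))) ∧
    (∀ K : Set ℂ, IsCompact K → K ⊆ D.carrier →
    ∀ᶠ δ : ℝ in 𝓝[>] 0, ∀ v : HexVertex, (δ : ℂ) * hexCenter v ∈ K → v ∈ Λ δ) ∧
    (∀ K : Set ℂ, IsCompact K → K ⊆ D'.carrier →
    ∀ᶠ δ : ℝ in 𝓝[>] 0, ∀ v : HexVertex, (δ : ℂ) * hexCenter v ∈ K → v ∈ Λ' δ) ∧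
    Tendsto (fun δ : ℝ => (δ : ℂ) * hexMidpoint (σa δ)) (𝓝[>] 0) (𝓝 (D.pt 0)) ∧
    Tendsto (fun δ : ℝ => (δ : ℂ) * hexMidpoint (σb δ)) (𝓝[>] 0) (𝓝 (D.pt 1)) ∧
    (∀ᶠ δ : ℝ in 𝓝[>] 0,
    Λ' δ ⊆ Λ'' δ ∧ Λ'' δ ⊆ Λ δ ∧
    (∀ v ∈ Λ δ, ∀ w ∈ Λ δ, hexGraph.Adj v w → (hexDomainGraph D.carrier δ).Adj v w) ∧
    (∀ v ∈ Λ' δ, ∀ w ∈ Λ' δ, hexGraph.Adj v w →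
    (embMeshGraph hexGraph hexCenter D'.carrier δ).Adj v w) ∧
    (∀ v ∈ Λ'' δ, ∀ w ∈ Λ δ, (δ : ℂ) * hexCenter w ∈ D'.carrier →
    (embMeshGraph hexGraph hexCenter D'.carrier δ).Adj v w → w ∈ Λ'' δ) ∧
    ((a δ).2 = 0 → m δ = (a δ).1 1 ∧ σa δ = s(a δ, ((a δ).1 - Pi.single 1 1, (1 : Fin 2)))) ∧
    ((a δ).2 = 1 → m δ = (a δ).1 1 + 1 ∧
    σa δ = s((((a δ).1 + Pi.single 1 1, (0 : Fin 2)) : HexVertex), a δ)) ∧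
    ((b δ).2 = 0 → σb δ = s(b δ, ((b δ).1 - Pi.single 1 1, (1 : Fin 2)))) ∧
    ((b δ).2 = 1 → σb δ = s((((b δ).1 + Pi.single 1 1, (0 : Fin 2)) : HexVertex), b δ))) ∧
    -- transparency of the construction
    (∀ δ : ℝ, 0 < δ → ((m δ : ℝ) - 2 / 3) * (δ * (Real.sqrt 3 / 2)) ≤ (D.pt 0).im ∧
      (D.pt 0).im < ((m δ : ℝ) + 1 / 3) * (δ * (Real.sqrt 3 / 2))) ∧
    ({z : ℂ | (D.pt 0).im < z.im} ∩ ball (D.pt 0) (16 * ρ') ⊆ D'.carrier) ∧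
    ({z : ℂ | (D.pt 0).im < z.im} ∩ ball (D.pt 1) (16 * ρ') ⊆ D'.carrier) ∧
    ∃ v₀ : ℝ → HexVertex,
      (∀ δ : ℝ, 0 < δ →
        dist ((δ : ℂ) * hexCenter (v₀ δ)) (D.pt 0 + ((4 * ρ' : ℝ) : ℂ) * Complex.I) ≤ δ) ∧
      (∀ᶠ δ : ℝ in 𝓝[>] 0, ∀ z : HexVertex, z ∈ Λ δ ↔ PathIn hexGraph
        {u : HexVertex | (δ : ℂ) * hexCenter u ∈ D.carrier ∧ m δ ≤ u.1 1 ∧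
          closedBall ((δ : ℂ) * hexCenter u) (25 * δ) ∩ {z : ℂ | (D.pt 0).im < z.im} ⊆
            D.carrier ∪ ball (D.pt 0) (12 * ρ') ∪ ball (D.pt 1) (12 * ρ')} (v₀ δ) z) ∧
      (∀ᶠ δ : ℝ in 𝓝[>] 0, ∀ z : HexVertex, z ∈ Λ' δ ↔ PathIn hexGraph
        {u : HexVertex | (δ : ℂ) * hexCenter u ∈ D'.carrier ∧ m δ ≤ u.1 1 ∧
          closedBall ((δ : ℂ) * hexCenter u) (25 * δ) ∩ {z : ℂ | (D.pt 0).im < z.im} ⊆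
            D'.carrier ∪ ball (D.pt 0) (12 * ρ') ∪ ball (D.pt 1) (12 * ρ')} (v₀ δ) z) ∧
      (∀ᶠ δ : ℝ in 𝓝[>] 0, ∀ z : HexVertex, z ∈ Λ'' δ ↔ z ∈ Λ δ ∧ PathIn hexGraph
        {x : HexVertex | x ∈ Λ δ ∧ (δ : ℂ) * hexCenter x ∈ D'.carrier} (v₀ δ) z) := by
  classical
  intro D D' ρ a b hfl hD' hend
  obtain ⟨hρ0, hpt, hDh, hfl0, hfl1⟩ := hfl
  obtain ⟨hab, hend'⟩ := hend
  have hD'D : D'.carrier ⊆ D.carrier := hD'.carrier_subset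
  have hD'h : D'.carrier ⊆ {z : ℂ | (D.pt 0).im < z.im} := hD'D.trans hDh
  -- radii
  obtain ⟨r0, hr0, hr0D'⟩ := Metric.eventually_nhds_iff.1 (hD'.eventually_mem 0)
  obtain ⟨r1, hr1, hr1D'⟩ := Metric.eventually_nhds_iff.1 (hD'.eventually_mem 1)
  set ρ' : ℝ := min ρ (min r0 r1) / 16 with hρ'
  have hmin : 0 < min ρ (min r0 r1) := lt_min hρ0 (lt_min hr0 hr1)
  have hρ'0 : 0 < ρ' := by positivity
  have h16ρ : 16 * ρ' ≤ ρ := by rw [hρ']; linarith [min_le_left ρ (min r0 r1)]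
  have h16r0 : 16 * ρ' ≤ r0 := by
    rw [hρ']; linarith [min_le_right ρ (min r0 r1), min_le_left r0 r1]
  have h16r1 : 16 * ρ' ≤ r1 := by
    rw [hρ']; linarith [min_le_right ρ (min r0 r1), min_le_right r0 r1]
  -- floor structure at radius `16 ρ'`
  have hflD0 : {z : ℂ | (D.pt 0).im < z.im} ∩ ball (D.pt 0) (16 * ρ') ⊆ D.carrier := fun z hz =>
    (show z ∈ D.carrier ∩ ball (D.pt 0) ρ by
      rw [hfl0]; exact ⟨hz.1, ball_subset_ball h16ρ hz.2⟩).1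
  have hflD1 : {z : ℂ | (D.pt 0).im < z.im} ∩ ball (D.pt 1) (16 * ρ') ⊆ D.carrier := fun z hz =>
    (show z ∈ D.carrier ∩ ball (D.pt 1) ρ by
      rw [hfl1, hpt]; exact ⟨hz.1, ball_subset_ball h16ρ hz.2⟩).1
  have hflD'0 : {z : ℂ | (D.pt 0).im < z.im} ∩ ball (D.pt 0) (16 * ρ') ⊆ D'.carrier := fun z hz =>
    hr0D' ((mem_ball.1 hz.2).trans_le h16r0) (hflD0 hz)
  have hflD'1 : {z : ℂ | (D.pt 0).im < z.im} ∩ ball (D.pt 1) (16 * ρ') ⊆ D'.carrier := fun z hz =>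
    hr1D' ((mem_ball.1 hz.2).trans_le h16r1) (hflD1 hz)
  -- the floor row and the bulk vertex
  set m : ℝ → ℤ := fun δ => ⌊(D.pt 0).im / (δ * (Real.sqrt 3 / 2)) + 2 / 3⌋ with hmdef
  have hm : ∀ δ : ℝ, 0 < δ → ((m δ : ℝ) - 2 / 3) * (δ * (Real.sqrt 3 / 2)) ≤ (D.pt 0).im ∧
      (D.pt 0).im < ((m δ : ℝ) + 1 / 3) * (δ * (Real.sqrt 3 / 2)) := fun δ hδ =>
    floor_row_spec (by positivity) _
  have hv₀ex : ∀ δ : ℝ, 0 < δ → ∃ v : HexVertex,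
      dist ((δ : ℂ) * hexCenter v) (D.pt 0 + ((4 * ρ' : ℝ) : ℂ) * Complex.I) ≤ δ := fun δ hδ =>
    exists_vertex_dist_le hδ _
  choose! v₀ hv₀ using hv₀ex
  have hv₀' : ∀ δ : ℝ, 0 < δ →
      dist ((δ : ℂ) * hexCenter (v₀ δ)) (D.pt 0 + ((16 * ρ' / 4 : ℝ) : ℂ) * Complex.I) ≤ δ := by
    intro δ hδ
    rw [show 16 * ρ' / 4 = 4 * ρ' by ring]
    exact hv₀ δ hδ
  -- Jordan exteriors
  have hE := D.toJordanDomain.isConnected_compl_closure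
    Literature.Topology.PlaneTopology.JordanCurveTheorem_holds
  have hE' := D'.toJordanDomain.isConnected_compl_closure
    Literature.Topology.PlaneTopology.JordanCurveTheorem_holds
  -- the inner families
  obtain ⟨L, hLall, hLK, hLrows⟩ := exists_innerFamily D.isOpen D.isConnected D.isBounded hDh hE.1
    hE.2 rfl hpt (by positivity : (0 : ℝ) < 16 * ρ') hflD0 hflD1 hm hv₀'
  obtain ⟨L', hL'all, hL'K, hL'rows⟩ := exists_innerFamily D'.isOpen D'.isConnected D'.isBounded
    hD'h hE'.1 hE'.2 rfl hpt (by positivity : (0 : ℝ) < 16 * ρ') hflD'0 hflD'1 hm hv₀'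
  have e12 : 3 * (16 * ρ') / 4 = 12 * ρ' := by ring
  have e1 : 16 * ρ' / 16 = ρ' := by ring
  rw [e12] at hLall hL'all
  rw [e1] at hLrows hL'rows
  -- deep sets are nested
  have hSS : ∀ δ : ℝ, {u : HexVertex | (δ : ℂ) * hexCenter u ∈ D'.carrier ∧ m δ ≤ u.1 1 ∧
      closedBall ((δ : ℂ) * hexCenter u) (25 * δ) ∩ {z : ℂ | (D.pt 0).im < z.im} ⊆
        D'.carrier ∪ ball (D.pt 0) (12 * ρ') ∪ ball (D.pt 1) (12 * ρ')} ⊆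
      {u : HexVertex | (δ : ℂ) * hexCenter u ∈ D.carrier ∧ m δ ≤ u.1 1 ∧
      closedBall ((δ : ℂ) * hexCenter u) (25 * δ) ∩ {z : ℂ | (D.pt 0).im < z.im} ⊆
        D.carrier ∪ ball (D.pt 0) (12 * ρ') ∪ ball (D.pt 1) (12 * ρ')} :=
    fun δ u ⟨h1, h2, h3⟩ => ⟨hD'D h1, h2,
      h3.trans (union_subset_union_left _ (union_subset_union_left _ hD'D))⟩
  -- endpoint limits
  have hσa : Tendsto (fun δ : ℝ => (δ : ℂ) * hexMidpoint s(a δ, if (a δ).2 = 0 then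
      (((a δ).1 - Pi.single 1 1, 1) : HexVertex) else ((a δ).1 + Pi.single 1 1, 0)))
      (𝓝[>] 0) (𝓝 (D.pt 0)) :=
    tendsto_smul_hexMidpoint hab.tendsto_fst (Eventually.of_forall fun δ =>
      hexGraph_adj_floorNeighbour (a δ))
  have hσb : Tendsto (fun δ : ℝ => (δ : ℂ) * hexMidpoint s(b δ, if (b δ).2 = 0 then
      (((b δ).1 - Pi.single 1 1, 1) : HexVertex) else ((b δ).1 + Pi.single 1 1, 0)))
      (𝓝[>] 0) (𝓝 (D.pt 1)) :=
    tendsto_smul_hexMidpoint hab.tendsto_snd (Eventually.of_forall fun δ =>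
      hexGraph_adj_floorNeighbour (b δ))
  have hσne := eventually_ne_of_tendsto_nhds (D.pt_injective.ne (by decide : (0 : Fin 2) ≠ 1)) hσa hσb
  have hne := eventually_ne_of_tendsto_nhds (D.pt_injective.ne (by decide : (0 : Fin 2) ≠ 1))
    hab.tendsto_fst hab.tendsto_snd
  have hballa := eventually_adj_mem_ball hρ'0 hab.tendsto_fst
  have hballb := eventually_adj_mem_ball hρ'0 hab.tendsto_snd
  -- THE FIXED-SCALE FACTS
  have hmain : ∀ᶠ δ : ℝ in 𝓝[>] 0, ∃ ia oa ib ob : HexVertex,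
      -- endpoint data
      (s(a δ, if (a δ).2 = 0 then (((a δ).1 - Pi.single 1 1, 1) : HexVertex)
        else ((a δ).1 + Pi.single 1 1, 0)) = s(oa, ia) ∧ ia ∈ L' δ ∧ oa ∉ L δ ∧
        hexGraph.Adj oa ia ∧ ia ∈ embMeshDomain hexGraph hexCenter D.carrier δ) ∧
      (s(b δ, if (b δ).2 = 0 then (((b δ).1 - Pi.single 1 1, 1) : HexVertex)
        else ((b δ).1 + Pi.single 1 1, 0)) = s(ob, ib) ∧ ib ∈ L' δ ∧ ob ∉ L δ ∧
        hexGraph.Adj ob ib) ∧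
      s(oa, ia) ≠ s(ob, ib) ∧
      ((a δ).2 = 0 → m δ = (a δ).1 1 ∧ s(a δ, if (a δ).2 = 0 then
        (((a δ).1 - Pi.single 1 1, 1) : HexVertex) else ((a δ).1 + Pi.single 1 1, 0)) =
          s(a δ, ((a δ).1 - Pi.single 1 1, (1 : Fin 2)))) ∧
      ((a δ).2 = 1 → m δ = (a δ).1 1 + 1 ∧ s(a δ, if (a δ).2 = 0 then
        (((a δ).1 - Pi.single 1 1, 1) : HexVertex) else ((a δ).1 + Pi.single 1 1, 0)) =
          s((((a δ).1 + Pi.single 1 1, (0 : Fin 2)) : HexVertex), a δ)) ∧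
      ((b δ).2 = 0 → s(b δ, if (b δ).2 = 0 then
        (((b δ).1 - Pi.single 1 1, 1) : HexVertex) else ((b δ).1 + Pi.single 1 1, 0)) =
          s(b δ, ((b δ).1 - Pi.single 1 1, (1 : Fin 2)))) ∧
      ((b δ).2 = 1 → s(b δ, if (b δ).2 = 0 then
        (((b δ).1 - Pi.single 1 1, 1) : HexVertex) else ((b δ).1 + Pi.single 1 1, 0)) =
          s((((b δ).1 + Pi.single 1 1, (0 : Fin 2)) : HexVertex), b δ)) ∧
      -- the families at this scale
      0 < δ ∧ δ ≤ ρ' ∧ hexDomainSimplyConnected (L δ) ∧ hexDomainSimplyConnected (L' δ) ∧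
      (hexGraph.induce (↑(L δ) : Set HexVertex)).Preconnected ∧
      (hexGraph.induce (↑(L' δ) : Set HexVertex)).Preconnected ∧
      (∀ z : HexVertex, z ∈ L δ ↔ PathIn hexGraph
        {u : HexVertex | (δ : ℂ) * hexCenter u ∈ D.carrier ∧ m δ ≤ u.1 1 ∧
          closedBall ((δ : ℂ) * hexCenter u) (25 * δ) ∩ {z : ℂ | (D.pt 0).im < z.im} ⊆
            D.carrier ∪ ball (D.pt 0) (12 * ρ') ∪ ball (D.pt 1) (12 * ρ')} (v₀ δ) z) ∧
      (∀ z : HexVertex, z ∈ L' δ ↔ PathIn hexGraph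
        {u : HexVertex | (δ : ℂ) * hexCenter u ∈ D'.carrier ∧ m δ ≤ u.1 1 ∧
          closedBall ((δ : ℂ) * hexCenter u) (25 * δ) ∩ {z : ℂ | (D.pt 0).im < z.im} ⊆
            D'.carrier ∪ ball (D.pt 0) (12 * ρ') ∪ ball (D.pt 1) (12 * ρ')} (v₀ δ) z) ∧
      (∀ v : HexVertex, m δ ≤ v.1 1 →
        (δ : ℂ) * hexCenter v ∈ ball (D.pt 0) ρ' ∪ ball (D.pt 1) ρ' → v ∈ L δ) ∧
      (∀ v : HexVertex, m δ ≤ v.1 1 →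
        (δ : ℂ) * hexCenter v ∈ ball (D.pt 0) ρ' ∪ ball (D.pt 1) ρ' → v ∈ L' δ) := by
    filter_upwards [Ioc_mem_nhdsGT hρ'0, hLall, hL'all, hLrows, hL'rows, hend', hab.reachable, hne,
      hballa, hballb, hσne] with δ hδ hA hA' hR hR' hE hReach hab' hBa hBb hσ
    obtain ⟨hsc, hconn, hchar⟩ := hA
    obtain ⟨hsc', hconn', hchar'⟩ := hA'
    have hΛS : ∀ v ∈ L δ, (δ : ℂ) * hexCenter v ∈ D.carrier ∧ m δ ≤ v.1 1 := fun v hv =>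
      ⟨((hchar v).1 hv).right_mem.1, ((hchar v).1 hv).right_mem.2.1⟩
    obtain ⟨⟨ua, hua, huaim⟩, ⟨ub, hub, hubim⟩⟩ := hE
    rw [hpt] at hubim
    have hab'' : a δ ≠ b δ := fun h => hab' (by rw [h])
    obtain ⟨wa, hwa⟩ := exists_adj_of_reachable hReach hab''
    obtain ⟨wb, hwb⟩ := exists_adj_of_reachable hReach.symm hab''.symm
    have haM : a δ ∈ embMeshDomain hexGraph hexCenter D.carrier δ := mem_embMeshDomain_of_adj hwa
    have haD : (δ : ℂ) * hexCenter (a δ) ∈ D.carrier := embMeshDomain_subset _ _ _ _ haM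
    have hbD : (δ : ℂ) * hexCenter (b δ) ∈ D.carrier :=
      embMeshDomain_subset _ _ _ _ (mem_embMeshDomain_of_adj hwb)
    obtain ⟨ia, oa, hσa_eq, hia, hoa, hoia, hia', hca0, hca1⟩ := floor_endpoint_data hδ.1
      (hm δ hδ.1).1 (hm δ hδ.1).2 hua (hDh haD) huaim hDh hΛS (fun v hvm hvb => hR' v hvm (Or.inl hvb)) hBa
    obtain ⟨ib, ob, hσb_eq, hib, hob, hoib, -, hcb0, hcb1⟩ := floor_endpoint_data hδ.1
      (hm δ hδ.1).1 (hm δ hδ.1).2 hub (hDh hbD) hubim hDh hΛS (fun v hvm hvb => hR' v hvm (Or.inr hvb)) hBb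
    have hiaM : ia ∈ embMeshDomain hexGraph hexCenter D.carrier δ := by
      rcases hia' with rfl | hadj
      · exact haM
      · have hiaD : (δ : ℂ) * hexCenter ia ∈ D.carrier := hD'D ((hchar' ia).1 hia).right_mem.1
        refine mem_embMeshDomain_of_meshAdj haM ((embMeshGraph_adj_iff _ _).2 ⟨hadj, ?_⟩)
          ((mem_embMeshVertices_iff _).2 hiaD)
        refine (segment_subset_of_floor (p := D.pt 0) (r := ρ') ⟨hDh haD, hBa _ (Or.inl rfl)⟩
          ⟨hDh hiaD, hBa _ (Or.inr hadj)⟩).trans fun z hz => subset_closure (hflD0 ⟨hz.1, ?_⟩)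
        exact ball_subset_ball (by linarith) hz.2
    have hσne' : s(oa, ia) ≠ s(ob, ib) := by
      intro heq
      apply hσ
      show (δ : ℂ) * hexMidpoint s(a δ, _) = (δ : ℂ) * hexMidpoint s(b δ, _)
      rw [hσa_eq, hσb_eq, heq]
    exact ⟨ia, oa, ib, ob, ⟨hσa_eq, hia, hoa, hoia, hiaM⟩, ⟨hσb_eq, hib, hob, hoib⟩, hσne', hca0,
      hca1, fun h => (hcb0 h).2, fun h => (hcb1 h).2, hδ.1, hδ.2, hsc, hsc', hconn, hconn', hchar,
      hchar', hR, hR'⟩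
  -- ASSEMBLY
  refine ⟨ρ', L, L', fun δ => (L δ).filter (fun z => PathIn hexGraph
      {x : HexVertex | x ∈ L δ ∧ (δ : ℂ) * hexCenter x ∈ D'.carrier} (v₀ δ) z), m,
    fun δ => s(a δ, if (a δ).2 = 0 then (((a δ).1 - Pi.single 1 1, 1) : HexVertex)
      else ((a δ).1 + Pi.single 1 1, 0)),
    fun δ => s(b δ, if (b δ).2 = 0 then (((b δ).1 - Pi.single 1 1, 1) : HexVertex)
      else ((b δ).1 + Pi.single 1 1, 0)),
    hρ'0, by linarith, ?_, hLK, hL'K, hσa, hσb, ?_, hm, hflD'0, hflD'1, v₀, hv₀,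
    hLall.mono fun δ h => h.2.2, hL'all.mono fun δ h => h.2.2,
    Eventually.of_forall fun δ z => Finset.mem_filter⟩
  · -- admissibility
    filter_upwards [hmain] with δ hM
    obtain ⟨ia, oa, ib, ob, ⟨hσa_eq, hia, hoa, hoia, -⟩, ⟨hσb_eq, hib, hob, hoib⟩, hσne', -, -, -, -,
      hδ, -, hsc, hsc', hconn, hconn', hchar, hchar', hR, hR'⟩ := hM
    have hΛS : ∀ v ∈ L δ, (δ : ℂ) * hexCenter v ∈ D.carrier ∧ m δ ≤ v.1 1 := fun v hv =>
      ⟨((hchar v).1 hv).right_mem.1, ((hchar v).1 hv).right_mem.2.1⟩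
    have hΛ'S : ∀ v ∈ L' δ, (δ : ℂ) * hexCenter v ∈ D'.carrier ∧ m δ ≤ v.1 1 := fun v hv =>
      ⟨((hchar' v).1 hv).right_mem.1, ((hchar' v).1 hv).right_mem.2.1⟩
    have hΛ'Λ : L' δ ⊆ L δ := fun z hz => (hchar z).2 (((hchar' z).1 hz).mono (hSS δ))
    rw [hσa_eq, hσb_eq]
    refine ⟨hΛ'Λ, hsc, hsc', hconn, hconn',
      (mem_hexDomainBoundary_of_adj (hΛ'Λ hia) hoa hoia.symm).2,
      (mem_hexDomainBoundary_of_adj (hΛ'Λ hib) hob hoib.symm).2,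
      (mem_hexDomainBoundary_of_adj hia (fun h => hoa (hΛ'Λ h)) hoia.symm).2,
      (mem_hexDomainBoundary_of_adj hib (fun h => hob (hΛ'Λ h)) hoib.symm).2,
      nonempty_hexMidEdgeSAW_of_preconnected hconn' hoia (fun h => hoa (hΛ'Λ h)) hia
        (fun h => hob (hΛ'Λ h)) hib hσne',
      hΛS, fun v hv => (hΛ'S v hv).1, fun v hv => ?_⟩
    exact ⟨⟨fun h => (hΛS v h).2, fun h => hR v h hv⟩, ⟨fun h => (hΛ'S v h).2, fun h => hR' v h hv⟩⟩
  · -- no bad edges, mesh edges, closure, floor matching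
    filter_upwards [hmain] with δ hM
    obtain ⟨ia, oa, ib, ob, ⟨-, hia, -, -, hiaM⟩, -, -, hca0, hca1, hcb0, hcb1,
      hδ, hδρ, -, -, hconn, -, hchar, hchar', -, -⟩ := hM
    have hΛS := fun v (hv : v ∈ L δ) => ((hchar v).1 hv).right_mem
    have hΛ'S := fun v (hv : v ∈ L' δ) => ((hchar' v).1 hv).right_mem
    have hΛ'Λ : L' δ ⊆ L δ := fun z hz => (hchar z).2 (((hchar' z).1 hz).mono (hSS δ))
    have hmeshD : ∀ v ∈ L δ, ∀ w ∈ L δ, hexGraph.Adj v w →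
        (embMeshGraph hexGraph hexCenter D.carrier δ).Adj v w := fun v hv w hw hadj =>
      (embMeshGraph_adj_iff _ _).2 ⟨hadj, (segment_subset_of_deep hDh hflD0 hflD1 (by linarith)
        hδ.le (by linarith) (hΛS v hv).2.2 (hΛS v hv).1 (hΛS w hw).1 hadj).trans subset_closure⟩
    refine ⟨fun z hz => ?_, Finset.filter_subset _ _, fun v hv w hw hadj => ?_,
      fun v hv w hw hadj => ?_, fun v hv w hw hwD' hadj => ?_, hca0, hca1, hcb0, hcb1⟩
    · rw [Finset.mem_filter]
      refine ⟨hΛ'Λ hz, (pathIn_component ((hchar' z).1 hz)).mono fun x hx => ?_⟩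
      exact ⟨(hchar x).2 (hx.mono (hSS δ)), hx.right_mem.1⟩
    · rw [embDomainGraph_adj_iff]
      exact ⟨hmeshD v hv w hw hadj,
        mem_embMeshDomain_of_preconnected hconn hmeshD (fun v hv => (hΛS v hv).1) (hΛ'Λ hia) hiaM hv,
        mem_embMeshDomain_of_preconnected hconn hmeshD (fun v hv => (hΛS v hv).1) (hΛ'Λ hia) hiaM hw⟩
    · exact (embMeshGraph_adj_iff _ _).2 ⟨hadj, (segment_subset_of_deep hD'h hflD'0 hflD'1
        (by linarith) hδ.le (by linarith) (hΛ'S v hv).2.2 (hΛ'S v hv).1 (hΛ'S w hw).1 hadj).trans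
          subset_closure⟩
    · rw [Finset.mem_filter] at hv ⊢
      exact ⟨hw, hv.2.tail (embMeshGraph_le _ _ _ _ hadj) ⟨hw, hwD'⟩⟩

end Discretisation

/-- **Registered sub-goal `stub_canonicalTransfer_meshPropagation`** (crux item
stmt-CriticalPhenomena-10472, line `floor-ratio-restriction-bootstrap`, stub
`stub_canonicalTransfer`): membership in the canonical discrete domain `Ω_δ` propagates along a
connected vertex set with mesh edges (registry form of `mem_embMeshDomain_of_preconnected`, the
"no bad edges" input of (M1)). [folklore] -/
theorem stub_canonicalTransfer_meshPropagation :
    ∀ (Ω : Set ℂ) (δ : ℝ) (Λ : Finset HexVertex) (i z : HexVertex),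
    (hexGraph.induce (↑Λ : Set HexVertex)).Preconnected →
    (∀ v ∈ Λ, ∀ w ∈ Λ, hexGraph.Adj v w → (embMeshGraph hexGraph hexCenter Ω δ).Adj v w) →
    (∀ v ∈ Λ, (δ : ℂ) * hexCenter v ∈ Ω) → i ∈ Λ → i ∈ embMeshDomain hexGraph hexCenter Ω δ →
    z ∈ Λ → z ∈ embMeshDomain hexGraph hexCenter Ω δ :=
  fun _ _ _ _ _ hconn hmesh hΩ hi hiM hz => mem_embMeshDomain_of_preconnected hconn hmesh hΩ hi hiM hz

end Summit.CriticalPhenomena.SAWScalingLimit.Theorems.ObservableToSLE.FloorRatio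

end
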